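/-
Copyright: b2b-lace cell (CriticalPhenomena). DESK DRAFT (carver-g58) — not filed; no numeral; d-generic.
-/
import Literature.Probability.FitznerVanDerHofstad2017.NobleJointTwoLevel
import Literature.Probability.FitznerVanDerHofstad2017.NobleBlocksPercSupport
import HarnessLib

/-!
# [FvdH17] §4.4 (4.65), `N = 1`: the DIAGONAL index `w = z = t = x` of the joint bounding event has positive mass

Source: R. Fitzner, R. van der Hofstad, *Mean-field behavior for nearest-neighbor percolation in `d > 10`*,
Electron. J. Probab. **22** (2017) no. 43, §4.4 (4.57)–(4.58), (4.65) (arXiv:1506.07977v2 pp. 41–43); App. C.1 of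
the arXiv version, displays (C.4)/(C.5) (pp. 79–80).

## What this file proves (no named fact, no hypothesis beyond the displayed ones)
For three distinct coordinate directions `a, b, c` of `ℤ^d` put `u = e_a`, `v = e_a + e_c`, `x = e_a + e_b`.  The
cylinder "the 4-cycle `(0, e_a, e_a+e_b, e_b)` is open at level `0` and the path `(v, e_a+e_b+e_c, x)` is open at
level `1`" lies inside the joint bounding event `jointWit u v w z t x` of `NobleJointTwoLevel` AT THE DIAGONAL INDEX
`w = z = t = x` (explicit bond-disjoint witnesses `K₀ = ({(0,e_a)}, {(0,e_b),(e_b,x)}, {(x,e_a)}, ∅)`,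
`K₁ = (path, ∅, ∅, ∅)`), hence `0 < ℙ_p^{⊗2}(jointWit u v x x x x)` for every `p > 0`
(`pi_jointWit_diag_pos`).  This index belongs to the class `(a,b) = (1,0)` of §6.1 (`‖u − w‖₁ = 1`: `u, w` joined
by a bond; `w ≠ 0`; last sausage trivial) and carries the weight `‖x‖₂² = ‖w‖₂² = 2 ≠ 0`.  A second cylinder does
the same for the class `(2,0)` (`‖u − w‖₁ = 2`): `u = e_a`, `w = z = t = x = e_b`, level `0` the same 4-cycle (now
read as the lines `{0↔u} = (0,e_a)`, `{0↔w} = (0,e_b)`, `{w↔u} = (e_b, e_a+e_b, e_a)`), level `1` the path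
`(v, e_c, e_b+e_c, e_b)` (`mem_jointWit_diag₂`, `pi_jointWit_diag₂_pos`).  The last lemma records that a repulsive
triangle whose first line is `{0 ←(≥ m+1)→ 0}` vanishes (`perc_T_geSucc_self₁_eq_zero`): the App. C.1 letters of
(C.4)/(C.5), whose line `x → w` carries length index `≥ 1` resp. `≥ 2`, are `0` on both indices (PATH READING of
`{v ←m→ x}`, `NobleBoundsN0` module docstring: consistent with the authors' (4.31)/(4.49)).
-/

noncomputable section

namespace Literature.Probability.FitznerVanDerHofstad2017

open Literature.Barriers.CriticalPhenomena Literature.Probability.Percolation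
open Literature.Probability.LatticeModels _root_.SimpleGraph
open MeasureTheory
open scoped ENNReal

variable {d : ℕ}

namespace XiOneDiagonal

/-! ### The six vertices and a separating functional -/

variable (a b c : Fin d)

/-- `e_a` (= `u`). [folklore] -/
abbrev A : Site d := Pi.single a 1
/-- `e_b` (= `w = z = t = x` of the class-`(2,0)` cylinder). [folklore] -/
abbrev B : Site d := Pi.single b 1
/-- `e_a + e_b` (= `w = z = t = x` of the class-`(1,0)` cylinder). [folklore] -/
abbrev X : Site d := Pi.single a 1 + Pi.single b 1
/-- `v = e_a + e_c` (the top of `b₀ = (u,v)`, `u = e_a`). [folklore] -/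
abbrev V : Site d := Pi.single a 1 + Pi.single c 1
/-- The middle vertex `e_a + e_b + e_c` of the class-`(1,0)` level-`1` path. [folklore] -/
abbrev M : Site d := Pi.single a 1 + Pi.single b 1 + Pi.single c 1
/-- `e_c`, a vertex of the class-`(2,0)` level-`1` path. [folklore] -/
abbrev Ec : Site d := Pi.single c 1
/-- `e_b + e_c`, a vertex of the class-`(2,0)` level-`1` path. [folklore] -/
abbrev BC : Site d := Pi.single b 1 + Pi.single c 1

/-- The separating functional `φ(y) = y_a + 2 y_b + 4 y_c` (values `0,1,2,3,5,7,4,6` on the eight vertices). [folklore] -/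
def φ (y : Site d) : ℤ := y a + 2 * y b + 4 * y c

variable {a b c}

/-- `φ(0) = 0`. [folklore] -/
private theorem φ_zero : φ a b c 0 = 0 := by simp [φ]
/-- `φ(e_a) = 1`. [folklore] -/
private theorem φ_A (hab : a ≠ b) (hac : a ≠ c) : φ a b c (A a) = 1 := by
  simp [φ, hab.symm, hac.symm]
/-- `φ(e_b) = 2`. [folklore] -/
private theorem φ_B (hab : a ≠ b) (hbc : b ≠ c) : φ a b c (B b) = 2 := by
  simp [φ, hab, hbc.symm]
/-- `φ(x) = 3`. [folklore] -/
private theorem φ_X (hab : a ≠ b) (hac : a ≠ c) (hbc : b ≠ c) : φ a b c (X a b) = 3 := by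
  simp [φ, hab, hab.symm, hac.symm, hbc.symm]
/-- `φ(v) = 5`. [folklore] -/
private theorem φ_V (hab : a ≠ b) (hac : a ≠ c) (hbc : b ≠ c) : φ a b c (V a c) = 5 := by
  simp [φ, hac, hab.symm, hac.symm, hbc]
/-- `φ(m) = 7`. [folklore] -/
private theorem φ_M (hab : a ≠ b) (hac : a ≠ c) (hbc : b ≠ c) : φ a b c (M a b c) = 7 := by
  simp [φ, hab, hac, hbc, hab.symm, hac.symm, hbc.symm]
/-- `φ(e_c) = 4`. [folklore] -/
private theorem φ_Ec (hac : a ≠ c) (hbc : b ≠ c) : φ a b c (Ec c) = 4 := by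
  simp [φ, hac, hbc]
/-- `φ(e_b + e_c) = 6`. [folklore] -/
private theorem φ_BC (hab : a ≠ b) (hac : a ≠ c) (hbc : b ≠ c) : φ a b c (BC b c) = 6 := by
  simp [φ, hab, hac, hbc, hbc.symm]

/-- Distinct `φ`-values separate vertices. [folklore] -/
private theorem ne_of_φ_ne {y y' : Site d} (h : φ a b c y ≠ φ a b c y') : y ≠ y' := fun hyy => h (hyy ▸ rfl)

/-- Distinct `Sym2.map φ`-values separate bonds. [folklore] -/
private theorem bond_ne_of_map_ne {e e' : Sym2 (Site d)} (h : Sym2.map (φ a b c) e ≠ Sym2.map (φ a b c) e') : e ≠ e' :=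
  fun hee => h (hee ▸ rfl)

/-! ### The witnesses -/

/-- Level-`0` open bonds: the 4-cycle `(0, e_a, e_a+e_b, e_b)` (both cylinders). [folklore] -/
def cyc (a b : Fin d) : Finset (Sym2 (Site d)) := {s(0, A a), s(0, B b), s(B b, X a b), s(X a b, A a)}

/-- Level-`1` open bonds of the class-`(1,0)` cylinder: the path `(v, e_a+e_b+e_c, e_a+e_b)`. [folklore] -/
def pth (a b c : Fin d) : Finset (Sym2 (Site d)) := {s(V a c, M a b c), s(M a b c, X a b)}

/-- Level-`1` open bonds of the class-`(2,0)` cylinder: the path `(v, e_c, e_b+e_c, e_b)`. [folklore] -/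
def pth₂ (a b c : Fin d) : Finset (Sym2 (Site d)) := {s(V a c, Ec c), s(Ec c, BC b c), s(BC b c, B b)}

/-- The level-`0` witnesses `K₀ = ({(0,e_a)}, {(0,e_b),(e_b,x)}, {(x,e_a)}, ∅)` of the lines
`{0↔u}, {0↔w}, {w↔u}, {w↔z}` at `w = z = x = e_a + e_b` (class `(1,0)`). [folklore] -/
def K₀ (a b : Fin d) : Fin 4 → Set (Sym2 (Site d)) :=
  ![{s(0, A a)}, {s(0, B b), s(B b, X a b)}, {s(X a b, A a)}, ∅]

/-- The level-`1` witnesses `K₁ = (path, ∅, ∅, ∅)` of the lines `{v↔t}, {t↔z}, {t↔x}, {z↔x}` at `t = z = x = e_a + e_b`. [folklore] -/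
def K₁ (a b c : Fin d) : Fin 4 → Set (Sym2 (Site d)) :=
  ![{s(V a c, M a b c), s(M a b c, X a b)}, ∅, ∅, ∅]

/-- The level-`0` witnesses `K₀' = ({(0,e_a)}, {(0,e_b)}, {(e_b,e_a+e_b),(e_a+e_b,e_a)}, ∅)` of the lines
`{0↔u}, {0↔w}, {w↔u}, {w↔z}` at `w = z = x = e_b` (class `(2,0)`: the line `{w↔u}` has two bonds). [folklore] -/
def K₀' (a b : Fin d) : Fin 4 → Set (Sym2 (Site d)) :=
  ![{s(0, A a)}, {s(0, B b)}, {s(B b, X a b), s(X a b, A a)}, ∅]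

/-- The level-`1` witnesses `K₁' = (path, ∅, ∅, ∅)` of the lines `{v↔t}, {t↔z}, {t↔x}, {z↔x}` at `t = z = x = e_b`. [folklore] -/
def K₁' (a b c : Fin d) : Fin 4 → Set (Sym2 (Site d)) :=
  ![{s(V a c, Ec c), s(Ec c, BC b c), s(BC b c, B b)}, ∅, ∅, ∅]

/-- An explicit open bond gives adjacency in the open graph. [folklore] -/
private theorem adj_of_mem {K : Set (Sym2 (Site d))} {y y' : Site d} (h : s(y, y') ∈ K) (hne : y ≠ y') :
    (openGraph K).Adj y y' := (openGraph_adj K y y').2 ⟨h, hne⟩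

/-- The four cycle bonds are edges of `ℤ^d`. [cite: FitznerVanDerHofstad2017, §1.1 (nearest-neighbour bonds) (arXiv:1506.07977v2 p. 2)] -/
theorem cyc_subset_edgeSet (a b : Fin d) : ((cyc a b : Finset (Sym2 (Site d))) : Set (Sym2 (Site d))) ⊆ (zdGraph d).edgeSet := by
  intro e he
  simp only [cyc, Finset.coe_insert, Finset.coe_singleton, Set.mem_insert_iff, Set.mem_singleton_iff] at he
  rcases he with rfl | rfl | rfl | rfl
  · exact (SimpleGraph.mem_edgeSet _).2 ((zdGraph_adj_iff _ _).2 ⟨a, Or.inl (by simp)⟩)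
  · exact (SimpleGraph.mem_edgeSet _).2 ((zdGraph_adj_iff _ _).2 ⟨b, Or.inl (by simp)⟩)
  · exact (SimpleGraph.mem_edgeSet _).2 ((zdGraph_adj_iff _ _).2 ⟨a, Or.inl (by rw [add_comm])⟩)
  · exact (SimpleGraph.mem_edgeSet _).2 ((zdGraph_adj_iff _ _).2 ⟨b, Or.inr rfl⟩)

/-- The two path bonds are edges of `ℤ^d`. [cite: FitznerVanDerHofstad2017, §1.1 (nearest-neighbour bonds) (arXiv:1506.07977v2 p. 2)] -/
theorem pth_subset_edgeSet (a b c : Fin d) : ((pth a b c : Finset (Sym2 (Site d))) : Set (Sym2 (Site d))) ⊆ (zdGraph d).edgeSet := by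
  intro e he
  simp only [pth, Finset.coe_insert, Finset.coe_singleton, Set.mem_insert_iff, Set.mem_singleton_iff] at he
  rcases he with rfl | rfl
  · exact (SimpleGraph.mem_edgeSet _).2 ((zdGraph_adj_iff _ _).2 ⟨b, Or.inl (by rw [add_right_comm])⟩)
  · exact (SimpleGraph.mem_edgeSet _).2 ((zdGraph_adj_iff _ _).2 ⟨c, Or.inr rfl⟩)

/-- The three bonds of the class-`(2,0)` path are edges of `ℤ^d`. [cite: FitznerVanDerHofstad2017, §1.1 (nearest-neighbour bonds) (arXiv:1506.07977v2 p. 2)] -/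
theorem pth₂_subset_edgeSet (a b c : Fin d) : ((pth₂ a b c : Finset (Sym2 (Site d))) : Set (Sym2 (Site d))) ⊆ (zdGraph d).edgeSet := by
  intro e he
  simp only [pth₂, Finset.coe_insert, Finset.coe_singleton, Set.mem_insert_iff, Set.mem_singleton_iff] at he
  rcases he with rfl | rfl | rfl
  · exact (SimpleGraph.mem_edgeSet _).2 ((zdGraph_adj_iff _ _).2 ⟨a, Or.inr (by rw [add_comm])⟩)
  · exact (SimpleGraph.mem_edgeSet _).2 ((zdGraph_adj_iff _ _).2 ⟨b, Or.inl (by rw [add_comm])⟩)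
  · exact (SimpleGraph.mem_edgeSet _).2 ((zdGraph_adj_iff _ _).2 ⟨c, Or.inr rfl⟩)

section witnesses

variable (hab : a ≠ b) (hac : a ≠ c) (hbc : b ≠ c)
include hab hac hbc

/-- **The class-`(1,0)` cylinder lies in the diagonal joint event.**  If the 4-cycle is open at level `0` and the
path `(v, e_a+e_b+e_c, x)` at level `1`, then `ω ∈ jointWit u v x x x x` (`u = e_a`, `v = e_a + e_c`, `x = e_a + e_b`;
`‖u − x‖₁ = 1`).
[cite: FitznerVanDerHofstad2017, §4.4 (4.57)–(4.58), (4.65) (arXiv:1506.07977v2 pp. 41–43)] -/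
theorem mem_jointWit_diag {ω : Fin 2 → BondConfig (Site d)}
    (h₀ : ((cyc a b : Finset _) : Set (Sym2 (Site d))) ⊆ ω 0) (h₁ : ((pth a b c : Finset _) : Set (Sym2 (Site d))) ⊆ ω 1) :
    ω ∈ jointWit (A a) (V a c) (X a b) (X a b) (X a b) (X a b) := by
  -- the φ-values
  have f0 := φ_zero (a := a) (b := b) (c := c)
  have fA := φ_A (c := c) hab hac
  have fB := φ_B (a := a) hab hbc
  have fX := φ_X hab hac hbc
  have fV := φ_V hab hac hbc
  have fM := φ_M hab hac hbc
  -- vertex separations (all via φ)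
  have hA0 : A a ≠ 0 := ne_of_φ_ne (by rw [fA, f0]; decide)
  have hB0 : (B b : Site d) ≠ 0 := ne_of_φ_ne (a := a) (b := b) (c := c) (by rw [fB, f0]; decide)
  have hXV : X a b ≠ V a c := ne_of_φ_ne (a := a) (b := b) (c := c) (by rw [fX, fV]; decide)
  have hXA : X a b ≠ A a := ne_of_φ_ne (a := a) (b := b) (c := c) (by rw [fX, fA]; decide)
  have hBX : (B b : Site d) ≠ X a b := ne_of_φ_ne (a := a) (b := b) (c := c) (by rw [fB, fX]; decide)
  have hVM : V a c ≠ M a b c := ne_of_φ_ne (a := a) (b := b) (c := c) (by rw [fV, fM]; decide)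
  have hMX : M a b c ≠ X a b := ne_of_φ_ne (a := a) (b := b) (c := c) (by rw [fM, fX]; decide)
  -- bond images under Sym2.map φ
  have g0A : Sym2.map (φ a b c) s(0, A a) = s(0, 1) := by rw [Sym2.map_mk, f0, fA]
  have g0B : Sym2.map (φ a b c) s(0, B b) = s(0, 2) := by rw [Sym2.map_mk, f0, fB]
  have gBX : Sym2.map (φ a b c) s(B b, X a b) = s(2, 3) := by rw [Sym2.map_mk, fB, fX]
  have gXA : Sym2.map (φ a b c) s(X a b, A a) = s(3, 1) := by rw [Sym2.map_mk, fX, fA]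
  have gVM : Sym2.map (φ a b c) s(V a c, M a b c) = s(5, 7) := by rw [Sym2.map_mk, fV, fM]
  have gMX : Sym2.map (φ a b c) s(M a b c, X a b) = s(7, 3) := by rw [Sym2.map_mk, fM, fX]
  have gAV : Sym2.map (φ a b c) s(A a, V a c) = s(1, 5) := by rw [Sym2.map_mk, fA, fV]
  -- membership of the single bonds in the configurations
  have m0A : s(0, A a) ∈ ω 0 := h₀ (by simp [cyc])
  have m0B : s(0, B b) ∈ ω 0 := h₀ (by simp [cyc])
  have mBX : s(B b, X a b) ∈ ω 0 := h₀ (by simp [cyc])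
  have mXA : s(X a b, A a) ∈ ω 0 := h₀ (by simp [cyc])
  have mVM : s(V a c, M a b c) ∈ ω 1 := h₁ (by simp [pth])
  have mMX : s(M a b c, X a b) ∈ ω 1 := h₁ (by simp [pth])
  -- off `{b₀}` at level 0: no cycle bond is `(u,v) = (e_a, e_a + e_c)`
  have off₀ : ∀ e ∈ ({s(0, A a), s(0, B b), s(B b, X a b), s(X a b, A a)} : Set (Sym2 (Site d))),
      e ∈ offBonds {s(A a, V a c)} (ω 0) := by
    intro e he
    simp only [Set.mem_insert_iff, Set.mem_singleton_iff] at he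
    refine ⟨?_, ?_⟩
    · rcases he with rfl | rfl | rfl | rfl <;> assumption
    · rw [Set.mem_singleton_iff]
      rcases he with rfl | rfl | rfl | rfl
      · exact bond_ne_of_map_ne (by rw [g0A, gAV]; decide)
      · exact bond_ne_of_map_ne (by rw [g0B, gAV]; decide)
      · exact bond_ne_of_map_ne (by rw [gBX, gAV]; decide)
      · exact bond_ne_of_map_ne (by rw [gXA, gAV]; decide)
  -- off `B(u)` at level 1: no path bond contains `u = e_a`
  have off₁ : ∀ e ∈ ({s(V a c, M a b c), s(M a b c, X a b)} : Set (Sym2 (Site d))),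
      e ∈ offBonds (bondsAt {A a}) (ω 1) := by
    intro e he
    simp only [Set.mem_insert_iff, Set.mem_singleton_iff] at he
    refine ⟨?_, fun hm => ?_⟩
    · rcases he with rfl | rfl <;> assumption
    · rw [mem_bondsAt_singleton_iff] at hm
      rcases he with rfl | rfl
      · rcases Sym2.mem_iff.1 hm with h | h
        · exact ne_of_φ_ne (a := a) (b := b) (c := c) (by rw [fA, fV]; decide) h
        · exact ne_of_φ_ne (a := a) (b := b) (c := c) (by rw [fA, fM]; decide) h
      · rcases Sym2.mem_iff.1 hm with h | h
        · exact ne_of_φ_ne (a := a) (b := b) (c := c) (by rw [fA, fM]; decide) h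
        · exact ne_of_φ_ne (a := a) (b := b) (c := c) (by rw [fA, fX]; decide) h
  refine (mem_jointWit_iff _ _ _ _ _ _ ω).2 ⟨?_, ?_⟩
  · -- JWSide u v w z t x
    exact ⟨fun h => absurd h hA0, Iff.rfl, hXV, hXV, hXA, hXA, hXA⟩
  · refine ⟨K₀ a b, K₁ a b c, ?_, ?_, ?_, ?_, ?_, ?_, ?_, ?_, ?_⟩
    · -- K₀ i ⊆ level-0 configuration off {b₀}
      refine forall_fin_four.2 ⟨?_, ?_, ?_, ?_⟩
      · intro e he
        simp only [K₀, Matrix.cons_val_zero, Set.mem_singleton_iff] at he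
        subst he; exact off₀ _ (by simp)
      · intro e he
        simp only [K₀, Matrix.cons_val_one] at he
        rcases he with rfl | rfl
        · exact off₀ _ (by simp)
        · exact off₀ _ (by simp)
      · intro e he
        simp only [K₀, Matrix.cons_val_two, Matrix.tail_cons, Matrix.head_cons, Set.mem_singleton_iff] at he
        subst he; exact off₀ _ (by simp)
      · intro e he; exact absurd he (Set.notMem_empty e)
    · -- K₁ i ⊆ level-1 configuration off B(u)
      refine forall_fin_four.2 ⟨?_, ?_, ?_, ?_⟩
      · intro e he; exact off₁ e he
      · intro e he; exact absurd he (Set.notMem_empty e)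
      · intro e he; exact absurd he (Set.notMem_empty e)
      · intro e he; exact absurd he (Set.notMem_empty e)
    · -- K₀ i witnesses its line: {0↔u}, {0↔w}, {w↔u}, {w↔z}
      refine forall_fin_four.2 ⟨?_, ?_, ?_, ?_⟩
      · show (openGraph ({s(0, A a)} : Set (Sym2 (Site d)))).Reachable 0 (A a)
        exact (adj_of_mem (by simp) hA0.symm).reachable
      · show (openGraph ({s(0, B b), s(B b, X a b)} : Set (Sym2 (Site d)))).Reachable 0 (X a b)
        exact (adj_of_mem (by simp) hB0.symm).reachable.trans (adj_of_mem (by simp) hBX).reachable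
      · show (openGraph ({s(X a b, A a)} : Set (Sym2 (Site d)))).Reachable (X a b) (A a)
        exact (adj_of_mem (by simp) hXA).reachable
      · show (openGraph (∅ : Set (Sym2 (Site d)))).Reachable (X a b) (X a b)
        exact Reachable.refl _
    · -- K₁ i witnesses its line: {v↔t}, {t↔z}, {t↔x}, {z↔x}
      refine forall_fin_four.2 ⟨?_, ?_, ?_, ?_⟩
      · show (openGraph ({s(V a c, M a b c), s(M a b c, X a b)} : Set (Sym2 (Site d)))).Reachable (V a c) (X a b)
        exact (adj_of_mem (by simp) hVM).reachable.trans (adj_of_mem (by simp) hMX).reachable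
      · show (openGraph (∅ : Set (Sym2 (Site d)))).Reachable (X a b) (X a b)
        exact Reachable.refl _
      · show (openGraph (∅ : Set (Sym2 (Site d)))).Reachable (X a b) (X a b)
        exact Reachable.refl _
      · show (openGraph (∅ : Set (Sym2 (Site d)))).Reachable (X a b) (X a b)
        exact Reachable.refl _
    · -- level-0 witnesses pairwise bond-disjoint
      refine pairwise_disjoint_vec4 ?_ ?_ ?_ ?_ ?_ ?_
      · refine Set.disjoint_left.2 fun e he he' => ?_
        simp only [Set.mem_insert_iff, Set.mem_singleton_iff] at he he'
        subst he
        rcases he' with h | h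
        · exact bond_ne_of_map_ne (by rw [g0A, g0B]; decide) h
        · exact bond_ne_of_map_ne (by rw [g0A, gBX]; decide) h
      · refine Set.disjoint_left.2 fun e he he' => ?_
        simp only [Set.mem_singleton_iff] at he he'
        subst he
        exact bond_ne_of_map_ne (by rw [g0A, gXA]; decide) he'
      · exact Set.disjoint_empty _
      · refine Set.disjoint_left.2 fun e he he' => ?_
        simp only [Set.mem_insert_iff, Set.mem_singleton_iff] at he he'
        subst he'
        rcases he with h | h
        · exact bond_ne_of_map_ne (by rw [g0B, gXA]; decide) h
        · exact bond_ne_of_map_ne (by rw [gBX, gXA]; decide) h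
      · exact Set.disjoint_empty _
      · exact Set.disjoint_empty _
    · -- level-1 witnesses pairwise bond-disjoint (three are empty)
      exact pairwise_disjoint_vec4 (Set.disjoint_empty _) (Set.disjoint_empty _) (Set.disjoint_empty _)
        (Set.disjoint_empty _) (Set.disjoint_empty _) (Set.empty_disjoint _)
    · -- the witness of {v↔t} is bond-disjoint from every level-0 witness
      refine forall_fin_four.2 ⟨?_, ?_, ?_, ?_⟩
      · refine Set.disjoint_left.2 fun e he he' => ?_
        simp only [K₁, K₀, Matrix.cons_val_zero, Set.mem_insert_iff, Set.mem_singleton_iff] at he he'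
        subst he'
        rcases he with h | h
        · exact bond_ne_of_map_ne (by rw [gVM, g0A]; decide) h
        · exact bond_ne_of_map_ne (by rw [gMX, g0A]; decide) h
      · refine Set.disjoint_left.2 fun e he he' => ?_
        simp only [K₁, K₀, Matrix.cons_val_zero, Matrix.cons_val_one, Set.mem_insert_iff,
          Set.mem_singleton_iff] at he he'
        rcases he with rfl | rfl
        · rcases he' with h | h
          · exact bond_ne_of_map_ne (by rw [gVM, g0B]; decide) h
          · exact bond_ne_of_map_ne (by rw [gVM, gBX]; decide) h
        · rcases he' with h | h
          · exact bond_ne_of_map_ne (by rw [gMX, g0B]; decide) h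
          · exact bond_ne_of_map_ne (by rw [gMX, gBX]; decide) h
      · refine Set.disjoint_left.2 fun e he he' => ?_
        simp only [K₁, K₀, Matrix.cons_val_zero, Matrix.cons_val_two, Matrix.tail_cons, Matrix.head_cons,
          Set.mem_insert_iff, Set.mem_singleton_iff] at he he'
        subst he'
        rcases he with h | h
        · exact bond_ne_of_map_ne (by rw [gVM, gXA]; decide) h
        · exact bond_ne_of_map_ne (by rw [gMX, gXA]; decide) h
      · show Disjoint (K₁ a b c 0) (∅ : Set (Sym2 (Site d)))
        exact Set.disjoint_empty _
    · -- the (empty) witness of {t↔z} is bond-disjoint from every level-0 witness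
      intro j
      show Disjoint (∅ : Set (Sym2 (Site d))) (K₀ a b j)
      exact Set.empty_disjoint _
    · -- last sausage trivial: `z = t`, nothing to check
      intro hzt; exact absurd rfl hzt

/-- **The diagonal index has positive mass, class `(1,0)`.**  For `p > 0`,
`0 < ℙ_p^{⊗2}(jointWit u v w z t x)` at `u = e_a`, `v = e_a + e_c`, `w = z = t = x = e_a + e_b`: the summand
`t = z = x = w` (`w ≠ 0`, `‖u − w‖₁ = 1`) of the bound (4.65)/(XiFs) is not empty.
[cite: FitznerVanDerHofstad2017, §4.4 (4.65) (arXiv:1506.07977v2 p. 43); App. C.1 (C.4)/(C.5) (pp. 79–80)] -/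
theorem pi_jointWit_diag_pos (p : unitInterval) (hp : 0 < (p : ℝ)) :
    0 < Measure.pi (fun _ : Fin 2 => bondPercolation (zdGraph d) p)
      (jointWit (A a) (V a c) (X a b) (X a b) (X a b) (X a b)) := by
  set P := bondPercolation (zdGraph d) p with hP
  -- the cylinder
  let S : Set (Fin 2 → BondConfig (Site d)) :=
    Set.pi Set.univ ![{α | ((cyc a b : Finset _) : Set (Sym2 (Site d))) ⊆ α},
      {β | ((pth a b c : Finset _) : Set (Sym2 (Site d))) ⊆ β}]
  have hSsub : S ⊆ jointWit (A a) (V a c) (X a b) (X a b) (X a b) (X a b) := by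
    intro ω hω
    have h0 : ((cyc a b : Finset _) : Set (Sym2 (Site d))) ⊆ ω 0 := by
      have := hω 0 (Set.mem_univ _); simpa using this
    have h1 : ((pth a b c : Finset _) : Set (Sym2 (Site d))) ⊆ ω 1 := by
      have := hω 1 (Set.mem_univ _); simpa using this
    exact mem_jointWit_diag hab hac hbc h0 h1
  have hS : Measure.pi (fun _ : Fin 2 => P) S =
      P {α | ((cyc a b : Finset _) : Set (Sym2 (Site d))) ⊆ α} * P {β | ((pth a b c : Finset _) : Set (Sym2 (Site d))) ⊆ β} := by
    rw [Measure.pi_pi, Fin.prod_univ_two]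
    rfl
  have hne : ∀ F : Finset (Sym2 (Site d)), ((F : Set (Sym2 (Site d))) ⊆ (zdGraph d).edgeSet) →
      P {α | (F : Set (Sym2 (Site d))) ⊆ α} ≠ 0 := by
    intro F hF h0
    have hreal := bondPercolation_real_setOf_subset (zdGraph d) p F hF
    rw [measureReal_def, ← hP, h0, ENNReal.toReal_zero] at hreal
    exact (pow_pos hp F.card).ne' hreal.symm
  have hpos : 0 < Measure.pi (fun _ : Fin 2 => P) S := by
    rw [hS]
    exact pos_iff_ne_zero.2 (mul_ne_zero (hne _ (cyc_subset_edgeSet a b)) (hne _ (pth_subset_edgeSet a b c)))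
  exact hpos.trans_le (measure_mono hSsub)

end witnesses

section witnesses₂

variable (hab : a ≠ b) (hac : a ≠ c) (hbc : b ≠ c)
include hab hac hbc

/-- **The class-`(2,0)` cylinder lies in the diagonal joint event.**  If the 4-cycle is open at level `0` and the
path `(v, e_c, e_b+e_c, e_b)` at level `1`, then `ω ∈ jointWit u v x x x x` with `u = e_a`, `v = e_a + e_c`, `x = e_b`
(`‖u − x‖₁ = 2`, `u, x` not joined by a bond: class `a = 2`).
[cite: FitznerVanDerHofstad2017, §4.4 (4.57)–(4.58), (4.65) (arXiv:1506.07977v2 pp. 41–43)] -/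
theorem mem_jointWit_diag₂ {ω : Fin 2 → BondConfig (Site d)}
    (h₀ : ((cyc a b : Finset _) : Set (Sym2 (Site d))) ⊆ ω 0) (h₁ : ((pth₂ a b c : Finset _) : Set (Sym2 (Site d))) ⊆ ω 1) :
    ω ∈ jointWit (A a) (V a c) (B b) (B b) (B b) (B b) := by
  -- the φ-values
  have f0 := φ_zero (a := a) (b := b) (c := c)
  have fA := φ_A (c := c) hab hac
  have fB := φ_B (a := a) hab hbc
  have fX := φ_X hab hac hbc
  have fV := φ_V hab hac hbc
  have fC := φ_Ec (b := b) hac hbc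
  have fBC := φ_BC hab hac hbc
  -- vertex separations (all via φ)
  have hA0 : A a ≠ 0 := ne_of_φ_ne (by rw [fA, f0]; decide)
  have hB0 : (B b : Site d) ≠ 0 := ne_of_φ_ne (a := a) (b := b) (c := c) (by rw [fB, f0]; decide)
  have hBV : (B b : Site d) ≠ V a c := ne_of_φ_ne (a := a) (b := b) (c := c) (by rw [fB, fV]; decide)
  have hBA : (B b : Site d) ≠ A a := ne_of_φ_ne (a := a) (b := b) (c := c) (by rw [fB, fA]; decide)
  have hBX : (B b : Site d) ≠ X a b := ne_of_φ_ne (a := a) (b := b) (c := c) (by rw [fB, fX]; decide)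
  have hXA : X a b ≠ A a := ne_of_φ_ne (a := a) (b := b) (c := c) (by rw [fX, fA]; decide)
  have hVC : V a c ≠ Ec c := ne_of_φ_ne (a := a) (b := b) (c := c) (by rw [fV, fC]; decide)
  have hCBC : (Ec c : Site d) ≠ BC b c := ne_of_φ_ne (a := a) (b := b) (c := c) (by rw [fC, fBC]; decide)
  have hBCB : BC b c ≠ B b := ne_of_φ_ne (a := a) (b := b) (c := c) (by rw [fBC, fB]; decide)
  -- bond images under Sym2.map φ
  have g0A : Sym2.map (φ a b c) s(0, A a) = s(0, 1) := by rw [Sym2.map_mk, f0, fA]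
  have g0B : Sym2.map (φ a b c) s(0, B b) = s(0, 2) := by rw [Sym2.map_mk, f0, fB]
  have gBX : Sym2.map (φ a b c) s(B b, X a b) = s(2, 3) := by rw [Sym2.map_mk, fB, fX]
  have gXA : Sym2.map (φ a b c) s(X a b, A a) = s(3, 1) := by rw [Sym2.map_mk, fX, fA]
  have gVC : Sym2.map (φ a b c) s(V a c, Ec c) = s(5, 4) := by rw [Sym2.map_mk, fV, fC]
  have gCBC : Sym2.map (φ a b c) s(Ec c, BC b c) = s(4, 6) := by rw [Sym2.map_mk, fC, fBC]
  have gBCB : Sym2.map (φ a b c) s(BC b c, B b) = s(6, 2) := by rw [Sym2.map_mk, fBC, fB]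
  have gAV : Sym2.map (φ a b c) s(A a, V a c) = s(1, 5) := by rw [Sym2.map_mk, fA, fV]
  -- membership of the single bonds in the configurations
  have m0A : s(0, A a) ∈ ω 0 := h₀ (by simp [cyc])
  have m0B : s(0, B b) ∈ ω 0 := h₀ (by simp [cyc])
  have mBX : s(B b, X a b) ∈ ω 0 := h₀ (by simp [cyc])
  have mXA : s(X a b, A a) ∈ ω 0 := h₀ (by simp [cyc])
  have mVC : s(V a c, Ec c) ∈ ω 1 := h₁ (by simp [pth₂])
  have mCBC : s(Ec c, BC b c) ∈ ω 1 := h₁ (by simp [pth₂])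
  have mBCB : s(BC b c, B b) ∈ ω 1 := h₁ (by simp [pth₂])
  -- off `{b₀}` at level 0: no cycle bond is `(u,v) = (e_a, e_a + e_c)`
  have off₀ : ∀ e ∈ ({s(0, A a), s(0, B b), s(B b, X a b), s(X a b, A a)} : Set (Sym2 (Site d))),
      e ∈ offBonds {s(A a, V a c)} (ω 0) := by
    intro e he
    simp only [Set.mem_insert_iff, Set.mem_singleton_iff] at he
    refine ⟨?_, ?_⟩
    · rcases he with rfl | rfl | rfl | rfl <;> assumption
    · rw [Set.mem_singleton_iff]
      rcases he with rfl | rfl | rfl | rfl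
      · exact bond_ne_of_map_ne (by rw [g0A, gAV]; decide)
      · exact bond_ne_of_map_ne (by rw [g0B, gAV]; decide)
      · exact bond_ne_of_map_ne (by rw [gBX, gAV]; decide)
      · exact bond_ne_of_map_ne (by rw [gXA, gAV]; decide)
  -- off `B(u)` at level 1: no path bond contains `u = e_a`
  have off₁ : ∀ e ∈ ({s(V a c, Ec c), s(Ec c, BC b c), s(BC b c, B b)} : Set (Sym2 (Site d))),
      e ∈ offBonds (bondsAt {A a}) (ω 1) := by
    intro e he
    simp only [Set.mem_insert_iff, Set.mem_singleton_iff] at he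
    refine ⟨?_, fun hm => ?_⟩
    · rcases he with rfl | rfl | rfl <;> assumption
    · rw [mem_bondsAt_singleton_iff] at hm
      rcases he with rfl | rfl | rfl
      · rcases Sym2.mem_iff.1 hm with h | h
        · exact ne_of_φ_ne (a := a) (b := b) (c := c) (by rw [fA, fV]; decide) h
        · exact ne_of_φ_ne (a := a) (b := b) (c := c) (by rw [fA, fC]; decide) h
      · rcases Sym2.mem_iff.1 hm with h | h
        · exact ne_of_φ_ne (a := a) (b := b) (c := c) (by rw [fA, fC]; decide) h
        · exact ne_of_φ_ne (a := a) (b := b) (c := c) (by rw [fA, fBC]; decide) h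
      · rcases Sym2.mem_iff.1 hm with h | h
        · exact ne_of_φ_ne (a := a) (b := b) (c := c) (by rw [fA, fBC]; decide) h
        · exact ne_of_φ_ne (a := a) (b := b) (c := c) (by rw [fA, fB]; decide) h
  refine (mem_jointWit_iff _ _ _ _ _ _ ω).2 ⟨?_, ?_⟩
  · -- JWSide u v w z t x
    exact ⟨fun h => absurd h hA0, Iff.rfl, hBV, hBV, hBA, hBA, hBA⟩
  · refine ⟨K₀' a b, K₁' a b c, ?_, ?_, ?_, ?_, ?_, ?_, ?_, ?_, ?_⟩
    · -- K₀' i ⊆ level-0 configuration off {b₀}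
      refine forall_fin_four.2 ⟨?_, ?_, ?_, ?_⟩
      · intro e he
        simp only [K₀', Matrix.cons_val_zero, Set.mem_singleton_iff] at he
        subst he; exact off₀ _ (by simp)
      · intro e he
        have he' : e = s(0, B b) := by simpa [K₀'] using he
        subst he'; exact off₀ _ (by simp)
      · intro e he
        simp only [K₀', Matrix.cons_val_two, Matrix.tail_cons, Matrix.head_cons] at he
        rcases he with rfl | rfl
        · exact off₀ _ (by simp)
        · exact off₀ _ (by simp)
      · intro e he; exact absurd he (Set.notMem_empty e)
    · -- K₁' i ⊆ level-1 configuration off B(u)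
      refine forall_fin_four.2 ⟨?_, ?_, ?_, ?_⟩
      · intro e he; exact off₁ e he
      · intro e he; exact absurd he (Set.notMem_empty e)
      · intro e he; exact absurd he (Set.notMem_empty e)
      · intro e he; exact absurd he (Set.notMem_empty e)
    · -- K₀' i witnesses its line: {0↔u}, {0↔w}, {w↔u}, {w↔z}
      refine forall_fin_four.2 ⟨?_, ?_, ?_, ?_⟩
      · show (openGraph ({s(0, A a)} : Set (Sym2 (Site d)))).Reachable 0 (A a)
        exact (adj_of_mem (by simp) hA0.symm).reachable
      · show (openGraph ({s(0, B b)} : Set (Sym2 (Site d)))).Reachable 0 (B b)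
        exact (adj_of_mem (by simp) hB0.symm).reachable
      · show (openGraph ({s(B b, X a b), s(X a b, A a)} : Set (Sym2 (Site d)))).Reachable (B b) (A a)
        exact (adj_of_mem (by simp) hBX).reachable.trans (adj_of_mem (by simp) hXA).reachable
      · show (openGraph (∅ : Set (Sym2 (Site d)))).Reachable (B b) (B b)
        exact Reachable.refl _
    · -- K₁' i witnesses its line: {v↔t}, {t↔z}, {t↔x}, {z↔x}
      refine forall_fin_four.2 ⟨?_, ?_, ?_, ?_⟩
      · show (openGraph ({s(V a c, Ec c), s(Ec c, BC b c), s(BC b c, B b)} : Set (Sym2 (Site d)))).Reachable (V a c) (B b)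
        exact ((adj_of_mem (by simp) hVC).reachable.trans (adj_of_mem (by simp) hCBC).reachable).trans
          (adj_of_mem (by simp) hBCB).reachable
      · show (openGraph (∅ : Set (Sym2 (Site d)))).Reachable (B b) (B b)
        exact Reachable.refl _
      · show (openGraph (∅ : Set (Sym2 (Site d)))).Reachable (B b) (B b)
        exact Reachable.refl _
      · show (openGraph (∅ : Set (Sym2 (Site d)))).Reachable (B b) (B b)
        exact Reachable.refl _
    · -- level-0 witnesses pairwise bond-disjoint
      refine pairwise_disjoint_vec4 ?_ ?_ ?_ ?_ ?_ ?_
      · refine Set.disjoint_left.2 fun e he he' => ?_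
        simp only [Set.mem_singleton_iff] at he he'
        subst he
        exact bond_ne_of_map_ne (by rw [g0A, g0B]; decide) he'
      · refine Set.disjoint_left.2 fun e he he' => ?_
        simp only [Set.mem_insert_iff, Set.mem_singleton_iff] at he he'
        subst he
        rcases he' with h | h
        · exact bond_ne_of_map_ne (by rw [g0A, gBX]; decide) h
        · exact bond_ne_of_map_ne (by rw [g0A, gXA]; decide) h
      · exact Set.disjoint_empty _
      · refine Set.disjoint_left.2 fun e he he' => ?_
        simp only [Set.mem_insert_iff, Set.mem_singleton_iff] at he he'
        subst he
        rcases he' with h | h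
        · exact bond_ne_of_map_ne (by rw [g0B, gBX]; decide) h
        · exact bond_ne_of_map_ne (by rw [g0B, gXA]; decide) h
      · exact Set.disjoint_empty _
      · exact Set.disjoint_empty _
    · -- level-1 witnesses pairwise bond-disjoint (three are empty)
      exact pairwise_disjoint_vec4 (Set.disjoint_empty _) (Set.disjoint_empty _) (Set.disjoint_empty _)
        (Set.disjoint_empty _) (Set.disjoint_empty _) (Set.empty_disjoint _)
    · -- the witness of {v↔t} is bond-disjoint from every level-0 witness
      refine forall_fin_four.2 ⟨?_, ?_, ?_, ?_⟩
      · refine Set.disjoint_left.2 fun e he he' => ?_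
        simp only [K₁', K₀', Matrix.cons_val_zero, Set.mem_insert_iff, Set.mem_singleton_iff] at he he'
        subst he'
        rcases he with h | h | h
        · exact bond_ne_of_map_ne (by rw [gVC, g0A]; decide) h
        · exact bond_ne_of_map_ne (by rw [gCBC, g0A]; decide) h
        · exact bond_ne_of_map_ne (by rw [gBCB, g0A]; decide) h
      · refine Set.disjoint_left.2 fun e he he' => ?_
        simp only [K₁', K₀', Matrix.cons_val_zero, Matrix.cons_val_one, Set.mem_insert_iff,
          Set.mem_singleton_iff] at he he'
        subst he'
        rcases he with h | h | h
        · exact bond_ne_of_map_ne (by rw [gVC, g0B]; decide) h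
        · exact bond_ne_of_map_ne (by rw [gCBC, g0B]; decide) h
        · exact bond_ne_of_map_ne (by rw [gBCB, g0B]; decide) h
      · refine Set.disjoint_left.2 fun e he he' => ?_
        simp only [K₁', K₀', Matrix.cons_val_zero, Matrix.cons_val_two, Matrix.tail_cons, Matrix.head_cons,
          Set.mem_insert_iff, Set.mem_singleton_iff] at he he'
        rcases he with rfl | rfl | rfl
        · rcases he' with h | h
          · exact bond_ne_of_map_ne (by rw [gVC, gBX]; decide) h
          · exact bond_ne_of_map_ne (by rw [gVC, gXA]; decide) h
        · rcases he' with h | h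
          · exact bond_ne_of_map_ne (by rw [gCBC, gBX]; decide) h
          · exact bond_ne_of_map_ne (by rw [gCBC, gXA]; decide) h
        · rcases he' with h | h
          · exact bond_ne_of_map_ne (by rw [gBCB, gBX]; decide) h
          · exact bond_ne_of_map_ne (by rw [gBCB, gXA]; decide) h
      · show Disjoint (K₁' a b c 0) (∅ : Set (Sym2 (Site d)))
        exact Set.disjoint_empty _
    · -- the (empty) witness of {t↔z} is bond-disjoint from every level-0 witness
      intro j
      show Disjoint (∅ : Set (Sym2 (Site d))) (K₀' a b j)
      exact Set.empty_disjoint _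
    · -- last sausage trivial: `z = t`, nothing to check
      intro hzt; exact absurd rfl hzt

/-- **The diagonal index has positive mass, class `(2,0)`.**  For `p > 0`,
`0 < ℙ_p^{⊗2}(jointWit u v w z t x)` at `u = e_a`, `v = e_a + e_c`, `w = z = t = x = e_b`: the summand
`t = z = x = w` (`w ≠ 0`, `‖u − w‖₁ = 2`) of the bound (4.65)/(XiFs) is not empty.
[cite: FitznerVanDerHofstad2017, §4.4 (4.65) (arXiv:1506.07977v2 p. 43); App. C.1 (C.5) (p. 80)] -/
theorem pi_jointWit_diag₂_pos (p : unitInterval) (hp : 0 < (p : ℝ)) :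
    0 < Measure.pi (fun _ : Fin 2 => bondPercolation (zdGraph d) p)
      (jointWit (A a) (V a c) (B b) (B b) (B b) (B b)) := by
  set P := bondPercolation (zdGraph d) p with hP
  let S : Set (Fin 2 → BondConfig (Site d)) :=
    Set.pi Set.univ ![{α | ((cyc a b : Finset _) : Set (Sym2 (Site d))) ⊆ α},
      {β | ((pth₂ a b c : Finset _) : Set (Sym2 (Site d))) ⊆ β}]
  have hSsub : S ⊆ jointWit (A a) (V a c) (B b) (B b) (B b) (B b) := by
    intro ω hω
    have h0 : ((cyc a b : Finset _) : Set (Sym2 (Site d))) ⊆ ω 0 := by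
      have := hω 0 (Set.mem_univ _); simpa using this
    have h1 : ((pth₂ a b c : Finset _) : Set (Sym2 (Site d))) ⊆ ω 1 := by
      have := hω 1 (Set.mem_univ _); simpa using this
    exact mem_jointWit_diag₂ hab hac hbc h0 h1
  have hS : Measure.pi (fun _ : Fin 2 => P) S =
      P {α | ((cyc a b : Finset _) : Set (Sym2 (Site d))) ⊆ α} * P {β | ((pth₂ a b c : Finset _) : Set (Sym2 (Site d))) ⊆ β} := by
    rw [Measure.pi_pi, Fin.prod_univ_two]
    rfl
  have hne : ∀ F : Finset (Sym2 (Site d)), ((F : Set (Sym2 (Site d))) ⊆ (zdGraph d).edgeSet) →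
      P {α | (F : Set (Sym2 (Site d))) ⊆ α} ≠ 0 := by
    intro F hF h0
    have hreal := bondPercolation_real_setOf_subset (zdGraph d) p F hF
    rw [measureReal_def, ← hP, h0, ENNReal.toReal_zero] at hreal
    exact (pow_pos hp F.card).ne' hreal.symm
  have hpos : 0 < Measure.pi (fun _ : Fin 2 => P) S := by
    rw [hS]
    exact pos_iff_ne_zero.2 (mul_ne_zero (hne _ (cyc_subset_edgeSet a b)) (hne _ (pth₂_subset_edgeSet a b c)))
  exact hpos.trans_le (measure_mono hSsub)

end witnesses₂

end XiOneDiagonal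

/-- **In `d ≥ 3` the diagonal index of (4.65) has positive mass** (directions `a = 0, b = 1, c = 2`).
[cite: FitznerVanDerHofstad2017, §4.4 (4.65) (arXiv:1506.07977v2 p. 43); App. C.1 (C.4)/(C.5) (pp. 79–80)] -/
theorem pi_jointWit_diag_pos_of_three_le (hd : 3 ≤ d) (p : unitInterval) (hp : 0 < (p : ℝ)) :
    0 < Measure.pi (fun _ : Fin 2 => bondPercolation (zdGraph d) p)
      (jointWit (XiOneDiagonal.A ⟨0, by omega⟩) (XiOneDiagonal.V ⟨0, by omega⟩ ⟨2, by omega⟩)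
        (XiOneDiagonal.X ⟨0, by omega⟩ ⟨1, by omega⟩) (XiOneDiagonal.X ⟨0, by omega⟩ ⟨1, by omega⟩)
        (XiOneDiagonal.X ⟨0, by omega⟩ ⟨1, by omega⟩) (XiOneDiagonal.X ⟨0, by omega⟩ ⟨1, by omega⟩)) :=
  XiOneDiagonal.pi_jointWit_diag_pos (by simp) (by simp) (by simp) p hp

/-- **In `d ≥ 3` the class-`(2,0)` diagonal index of (4.65) has positive mass** (directions `a = 0, b = 1, c = 2`).
[cite: FitznerVanDerHofstad2017, §4.4 (4.65) (arXiv:1506.07977v2 p. 43); App. C.1 (C.5) (p. 80)] -/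
theorem pi_jointWit_diag₂_pos_of_three_le (hd : 3 ≤ d) (p : unitInterval) (hp : 0 < (p : ℝ)) :
    0 < Measure.pi (fun _ : Fin 2 => bondPercolation (zdGraph d) p)
      (jointWit (XiOneDiagonal.A ⟨0, by omega⟩) (XiOneDiagonal.V ⟨0, by omega⟩ ⟨2, by omega⟩)
        (XiOneDiagonal.B ⟨1, by omega⟩) (XiOneDiagonal.B ⟨1, by omega⟩)
        (XiOneDiagonal.B ⟨1, by omega⟩) (XiOneDiagonal.B ⟨1, by omega⟩)) :=
  XiOneDiagonal.pi_jointWit_diag₂_pos (a := ⟨0, by omega⟩) (b := ⟨1, by omega⟩) (c := ⟨2, by omega⟩)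
    (by simp) (by simp) (by simp) p hp

namespace NobleBlocks

open LenIdx

/-- **A repulsive triangle whose first line is the closed simple path `{0 ←(≥ m+1)→ 0}` vanishes**: by
the PATH READING of `{v ←m→ x}` (`NobleBoundsN0.openConnGe_self_eq_empty`: `{v ←m→ v} = ∅` for `m ≥ 1`, consistent
with the authors' (4.31)/(4.49)) `𝓣_{(≥ m+1), j₂, j₃}(0, x₂, x₃) = 0` — the App. C.1 letters of (C.4) (`m + 1 = 1`) and
(C.5) (`m + 1 = 2`) read at the diagonal `x = w` of either class.
[cite: FitznerVanDerHofstad2017, §4.2 (4.17) and Lemma 4.3 (4.31) (arXiv:1506.07977v2 pp. 34–36); App. C.1 (C.4)/(C.5) (pp. 79–80)] -/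
theorem perc_T_geSucc_self₁_eq_zero (p : unitInterval) (m : ℕ) (j₂ j₃ : LenIdx) (x₂ x₃ : Site d) :
    (Letters.perc d p).T (.ge (m + 1)) j₂ j₃ 0 x₂ x₃ = 0 := by
  rw [perc_T]
  refine repLetter_eq_zero_of_null p _ 0 (isUpperSet_event (.ge (m + 1)) 0 0) ?_
  have h : (lineEvents₃ (.ge (m + 1)) j₂ j₃ (0 : Site d) x₂ x₃ 0) = ∅ := by
    simp only [lineEvents₃, Matrix.cons_val_zero]
    exact event_self_eq_empty (j := .ge (m + 1)) (Nat.succ_ne_zero m) 0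
  rw [h, measure_empty]

end NobleBlocks

end Literature.Probability.FitznerVanDerHofstad2017

end
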